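import Mathlib

/-!
# The vertex principle for formally dissipative functionals (kernel of the seat's §3.1)

Solo seat `solo-NavierStokesRegularity-informed` (new mathematics *about the summit statement*: the
certified core of a no-go theorem for monotone quantities, not a substitute theorem).

A positive proof of Clay (A) by a "monotonicity formula" needs a functional `Q` of the velocity with
`(d/dt) Q(u(t)) ≤ 0` along every solution and enough coercivity at critical scaling. Every such
formula is proved as *formal dissipativity*: `Q'(u)[ν Δu - P∇·(u ⊗ u)] ≤ 0` for every Schwartz
divergence-free `u`. Split `Q = ∑ᵢ Qᵢ` into pieces that are bi-homogeneous under the two scalings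
`u ↦ l • u` (amplitude, degree `dᵢ`) and `u ↦ u(m •)` (dilation, degree `eᵢ`) and even under
`u ↦ -u`. Then the *Stokes rate* `Aᵢ(u) = Qᵢ'(u)[Δu]` transforms with the monomial
`l ^ dᵢ * m ^ (eᵢ + 2)` and is even, while the *Euler rate* `Bᵢ(u) = -Qᵢ'(u)[P∇·(u ⊗ u)]`
transforms with `l ^ (dᵢ + 1) * m ^ (eᵢ + 1)` and is odd; formal dissipativity says
`∑ᵢ (ν Aᵢ(u) + Bᵢ(u)) ≤ 0` for all `u`.

This file proves, over an ABSTRACT carrier `X` with abstract scaling maps `T l m : X → X` and an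
abstract involution `neg : X → X` (so that nothing about Navier–Stokes is assumed — the four
transformation laws are the hypotheses), the two facts that drive the classification in the seat's
paper (§3.1, Theorem L3):

* `coeff_nonpos_of_exponent_lt`: if `∑ₖ cₖ s ^ rₖ ≤ 0` for all `s > 0` and `r k₀` strictly exceeds
  every other exponent, then `c k₀ ≤ 0` (isolation of a Newton-polygon vertex along `s → ∞`);
* `eulerRate_eq_zero_of_exposed`: if a direction `(α, β)` of the two scalings exposes the Euler-rate
  term of the piece `i₀` strictly (its exponent `α (d i₀ + 1) + β (e i₀ + 1)` beats every Stokes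
  exponent `α dⱼ + β (eⱼ + 2)` and every other Euler exponent), then `B i₀ ≡ 0`: that piece is an
  exact conservation law of the inertial (Euler) dynamics;
* `stokesRate_nonpos_of_exposed`: if instead the Stokes-rate term of `i₀` is strictly exposed, then
  `ν * A i₀ u ≤ 0` for every `u`.

Choosing the direction is bookkeeping done in the paper: pure amplitude `(1, ±β)` exposes the pieces
of maximal degree, and `(1 + ε, 1)` exposes the piece of maximal Navier–Stokes weight `dᵢ + eᵢ`;
combined with Serre's classification of first-order integral invariants of 3D Euler
[cite: Serre1984, as quoted in Serre, C. R. Mécanique 346 (2018) p. 177] this leaves the kinetic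
energy as the only formally dissipative first-order local functional (paper §3.1, Corollary L4).
All statements here are elementary real analysis. [folklore-level; no source states them]
-/

noncomputable section

open Filter Topology Finset
open scoped BigOperators

namespace Summit.NavierStokesRegularity.NavierStokesRegularity.Theorems

section Isolation

variable {κ : Type*} [Fintype κ]

/-- **Isolation of the top exponent.** If a finite signed combination of real powers
`∑ₖ cₖ s ^ rₖ` is `≤ 0` for every `s > 0` and the exponent `r k₀` is strictly larger than every other
exponent, then its coefficient is `≤ 0`: divide by `s ^ r k₀` and let `s → ∞`. [folklore] -/
theorem coeff_nonpos_of_exponent_lt (c r : κ → ℝ) (k₀ : κ)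
    (hmax : ∀ k, k ≠ k₀ → r k < r k₀)
    (h : ∀ s : ℝ, 0 < s → ∑ k, c k * s ^ (r k) ≤ 0) : c k₀ ≤ 0 := by
  classical
  -- the normalised sums are still nonpositive
  have key : ∀ s : ℝ, 0 < s → ∑ k, c k * s ^ (r k - r k₀) ≤ 0 := by
    intro s hs
    have hfac : ∑ k, c k * s ^ (r k - r k₀) = s ^ (-r k₀) * ∑ k, c k * s ^ (r k) := by
      rw [Finset.mul_sum]
      refine Finset.sum_congr rfl fun k _ => ?_
      rw [Real.rpow_sub hs, Real.rpow_neg hs.le, div_eq_mul_inv]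
      ring
    rw [hfac]
    exact mul_nonpos_of_nonneg_of_nonpos (Real.rpow_nonneg hs.le _) (h s hs)
  -- and they converge to `c k₀`
  have hlim : Tendsto (fun s : ℝ => ∑ k, c k * s ^ (r k - r k₀)) atTop (𝓝 (c k₀)) := by
    have hc : c k₀ = ∑ k, (if k = k₀ then c k₀ else 0) := by simp
    rw [hc]
    refine tendsto_finsetSum _ fun k _ => ?_
    by_cases hk : k = k₀
    · subst hk
      simp only [sub_self, Real.rpow_zero, mul_one, if_true]
      exact tendsto_const_nhds
    · simp only [hk, if_false]
      have hpos : 0 < r k₀ - r k := by linarith [hmax k hk]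
      have ht := (tendsto_rpow_neg_atTop hpos).const_mul (c k)
      rw [mul_zero] at ht
      refine ht.congr' ?_
      filter_upwards [eventually_gt_atTop (0 : ℝ)] with s hs
      congr 1
      rw [neg_sub]
  exact le_of_tendsto hlim (by
    filter_upwards [eventually_gt_atTop (0 : ℝ)] with s hs using key s hs)

end Isolation

section Vertex

variable {ι X : Type*} [Fintype ι]

/-! ### The vertex principle over an abstract carrier

Data: a carrier `X` with a two-parameter family of maps `T l m` ("amplitude `l`, dilation `m`") and a
map `neg` ("`u ↦ -u`"); finitely many pieces `i : ι` with amplitude degree `d i`, dilation degree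
`e i`, a *Stokes rate* `A i` transforming with `l ^ d i * m ^ (e i + 2)` and even under `neg`, and an
*Euler rate* `B i` transforming with `l ^ (d i + 1) * m ^ (e i + 1)` and odd under `neg`; `ν` is the
viscosity; formal dissipativity is `∑ i, (ν * A i u + B i u) ≤ 0` for all `u`. For a genuine
functional `Q = ∑ Qᵢ` on Schwartz divergence-free fields these laws follow from bi-homogeneity and
evenness of the `Qᵢ` by the chain rule (paper §3.1, Lemma L1); here they are the hypotheses
`hS hE hev hod hdiss`. -/

variable (T : ℝ → ℝ → X → X) (neg : X → X) (ν : ℝ) (d e : ι → ℝ) (A B : ι → X → ℝ)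
  (hS : ∀ i (l m : ℝ) (u : X), 0 < l → 0 < m → A i (T l m u) = l ^ (d i) * m ^ (e i + 2) * A i u)
  (hE : ∀ i (l m : ℝ) (u : X), 0 < l → 0 < m →
    B i (T l m u) = l ^ (d i + 1) * m ^ (e i + 1) * B i u)
  (hev : ∀ i u, A i (neg u) = A i u) (hod : ∀ i u, B i (neg u) = -B i u)
  (hdiss : ∀ u, ∑ i, (ν * A i u + B i u) ≤ 0)

include hS hE hdiss in
/-- Along the curve `s ↦ T (s ^ α) (s ^ β) u` the dissipation inequality becomes a signed
combination of powers of `s`, indexed by `ι ⊕ ι` (Stokes terms, then Euler terms). [folklore] -/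
theorem dissipative_sum_rpow_nonpos (α β : ℝ) (u : X) (s : ℝ) (hs : 0 < s) :
    ∑ k : ι ⊕ ι, (Sum.elim (fun j => ν * A j u) (fun j => B j u) k) *
        s ^ (Sum.elim (fun j => α * d j + β * (e j + 2)) (fun j => α * (d j + 1) + β * (e j + 1)) k)
      ≤ 0 := by
  have hl : 0 < s ^ α := Real.rpow_pos_of_pos hs α
  have hm : 0 < s ^ β := Real.rpow_pos_of_pos hs β
  have h := hdiss (T (s ^ α) (s ^ β) u)
  rw [Fintype.sum_sum_type]
  simp only [Sum.elim_inl, Sum.elim_inr]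
  rw [← Finset.sum_add_distrib]
  convert h using 2 with j _
  rw [hS j _ _ u hl hm, hE j _ _ u hl hm, ← Real.rpow_mul hs.le,
    ← Real.rpow_mul hs.le, ← Real.rpow_mul hs.le, ← Real.rpow_mul hs.le, Real.rpow_add hs,
    Real.rpow_add hs]
  ring

include hS hE hod hdiss in
/-- **Exposed Euler vertex ⇒ exact Euler conservation law.** If some direction `(α, β)` of the two
scalings makes the exponent of the Euler-rate term of the piece `i₀` strictly larger than the
exponents of all Stokes-rate terms and of all other Euler-rate terms, then `B i₀ u = 0` for every
`u`: the inequality isolates `B i₀ u ≤ 0`, and oddness under `neg` gives `-B i₀ u ≤ 0` as well.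
(Paper §3.1, Theorem L3 (i); the choices `(1, ±β)` and `(1 + ε, 1)` of the paper give (ii-a),
(ii-b).) [folklore] -/
theorem eulerRate_eq_zero_of_exposed (i₀ : ι) (α β : ℝ)
    (hA : ∀ j, α * d j + β * (e j + 2) < α * (d i₀ + 1) + β * (e i₀ + 1))
    (hB : ∀ j, j ≠ i₀ → α * (d j + 1) + β * (e j + 1) < α * (d i₀ + 1) + β * (e i₀ + 1)) :
    ∀ u, B i₀ u = 0 := by
  classical
  -- one-sided bound for every `u`
  have hle : ∀ u, B i₀ u ≤ 0 := by
    intro u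
    have := coeff_nonpos_of_exponent_lt (κ := ι ⊕ ι)
      (Sum.elim (fun j => ν * A j u) (fun j => B j u))
      (Sum.elim (fun j => α * d j + β * (e j + 2)) (fun j => α * (d j + 1) + β * (e j + 1)))
      (Sum.inr i₀) ?_ (fun s hs => dissipative_sum_rpow_nonpos T ν d e A B hS hE hdiss α β u s hs)
    · simpa using this
    · rintro (j | j) hk
      · simpa using hA j
      · have hj : j ≠ i₀ := fun h => hk (by rw [h])
        simpa using hB j hj
  intro u
  have h₁ := hle u
  have h₂ := hle (neg u)
  rw [hod] at h₂
  linarith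

include hS hE hdiss in
/-- **Exposed Stokes vertex ⇒ dissipation sign.** If some direction `(α, β)` makes the exponent of the
Stokes-rate term of `i₀` strictly larger than those of all other Stokes-rate terms and of all
Euler-rate terms, then `ν * A i₀ u ≤ 0` for every `u`. (Paper §3.1, Theorem L3 (ii-b), second
clause.) [folklore] -/
theorem stokesRate_nonpos_of_exposed (i₀ : ι) (α β : ℝ)
    (hA : ∀ j, j ≠ i₀ → α * d j + β * (e j + 2) < α * d i₀ + β * (e i₀ + 2))
    (hB : ∀ j, α * (d j + 1) + β * (e j + 1) < α * d i₀ + β * (e i₀ + 2)) :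
    ∀ u, ν * A i₀ u ≤ 0 := by
  classical
  intro u
  have := coeff_nonpos_of_exponent_lt (κ := ι ⊕ ι)
    (Sum.elim (fun j => ν * A j u) (fun j => B j u))
    (Sum.elim (fun j => α * d j + β * (e j + 2)) (fun j => α * (d j + 1) + β * (e j + 1)))
    (Sum.inl i₀) ?_ (fun s hs => dissipative_sum_rpow_nonpos T ν d e A B hS hE hdiss α β u s hs)
  · simpa using this
  · rintro (j | j) hk
    · have hj : j ≠ i₀ := fun h => hk (by rw [h])
      simpa using hA j hj
    · simpa using hB j

include hS hE hod hdiss in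
/-- **A single piece is an Euler invariant.** With one piece only (every index equals `i₀`), the pure
amplitude direction `(1, 0)` exposes its Euler-rate term (exponent `d + 1` against `d`), so a formally
dissipative even bi-homogeneous functional is an exact Euler conservation law. [folklore] -/
theorem eulerRate_eq_zero_of_subsingleton [Subsingleton ι] (i₀ : ι) : ∀ u, B i₀ u = 0 := by
  refine eulerRate_eq_zero_of_exposed T neg ν d e A B hS hE hod hdiss i₀ 1 0 (fun j => ?_)
    (fun j hj => ?_)
  · rw [Subsingleton.elim j i₀]; linarith
  · exact (hj (Subsingleton.elim j i₀)).elim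

include hS hE hdiss in
/-- … and its Stokes rate has the dissipative sign: with one piece the direction `(-1, 0)` (amplitude
`→ 0`) exposes the Stokes-rate term. [folklore] -/
theorem stokesRate_nonpos_of_subsingleton [Subsingleton ι] (i₀ : ι) : ∀ u, ν * A i₀ u ≤ 0 := by
  refine stokesRate_nonpos_of_exposed T ν d e A B hS hE hdiss i₀ (-1) 0 (fun j hj => ?_)
    (fun j => ?_)
  · exact (hj (Subsingleton.elim j i₀)).elim
  · rw [Subsingleton.elim j i₀]; linarith

end Vertex

end Summit.NavierStokesRegularity.NavierStokesRegularity.Theorems
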